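import Summits.BirchSwinnertonDyer.BirchSwinnertonDyer.Theorems.ByReductionTypeAtTwoTorsionEulerCharH46Levelwise
import Summits.BirchSwinnertonDyer.BirchSwinnertonDyer.Theorems.ByReductionTypeAtTwoTorsionEulerCharH46Obstruction
import Summits.BirchSwinnertonDyer.BirchSwinnertonDyer.Theorems.ByReductionTypeAtTwoTorsionEulerCharH46RealiserStrict
import Summits.BirchSwinnertonDyer.BirchSwinnertonDyer.Theorems.ByReductionTypeAtTwoTorsionEulerCharH46RealiserValue
import Summits.BirchSwinnertonDyer.BirchSwinnertonDyer.Theorems.ThetaPartnerAtTwoSignedMainConjectureCMTwoRankZeroPTDeepSelmerTransport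
import Literature.NumberTheory.EllipticCurves.LocalKummerSequenceSurjective
import HarnessLib

/-!
# Greenberg LNM 1716 Lemma 4.6 on `Γ`-invariants (H46), kernel road C′, brick B7 (assembly CLOSED MODULO the two sockets):
# the H46 realiser for `z = res_⊤ (κ_{v₀} zt)` from the levelwise Poitou–Tate call, GIVEN the condition at `p` (socket HP) and the
# orthogonality at `v₀` (socket HB6)

Cell `bsd-2adic` (run/shared/lean/pub/bsd-2adic/), seat `bsd-2adic-tower-1` GEN 34; `--supports stmt-BirchSwinnertonDyer-19271` (helper).
THEOREMS ONLY (no definition, no named fact, no `sorry`); closes no item; nothing booked; BSD is not proved by any of this. This file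
COMPOSES the landed bricks of road C′ — B4 (`…H46Levelwise.exists_layerClass_prescribed_of_orthogonal`, the `SelmerComplement` call on
`Maps(Γ_ℚ ⧸ Γ_n, E[p^k])` with THE Weil pairing `CyclotomicLayer.weilTowerPk W k`), B4b (`…H46Obstruction.localTatePairingZMod_unit_coindTateDual_shapiroLift`,
the obstruction term at `v₀` is `inv_{v₀}(zt ∪ loc_{v₀} cor b)`), B5 (`…H46Realiser.*`: the realiser `T(c) = h_n (push c)` is Kummer at the strict
places, at `∞`, at the good places, and has local value `res_⊤ (κ_{v₀} zt)` at `v₀`) — into ONE kernel theorem whose only non-structural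
hypotheses are the two remaining SOCKETS of the programme, stated in the exact currency the missing bricks must deliver:

* (HP) at the places `v ∈ Sp` (above `p`): a local condition `Lp v`, a layer predicate `Λp v` with its dual control `hLdual` (B4's interface), and
  the realiser consequence `loc_v (Sh c) ∈ Lp v ⟹ conj_σ T(c) ∈ localKerOver p Γ_∞ ℚ_v` (to be supplied by the Greenberg Lagrangian `C_v[p^k]`
  + Prop. 2.4, bricks B3/B5 §4);
* (HB6) at `v₀`: `inv_{v₀}(zt ∪_{Weil} loc_{v₀} (cor b)) = 0` for every layer class `b ∈ H¹(Γ_n, E[p^k])` unramified outside `S ∪ {v₀}` with `Λp` at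
  `Sp` (to be supplied by the universal-norm brick B6 — Greenberg pp. 105–108 — after the Weil level reduction).

* `exists_realiser_of_sockets` — for `K = ℚ`, `p` prime, `κ` the cyclotomic `ℤ_p`-extension, `S ⊇ Sp` with `p ∉ v` and good reduction off
  `S`, `v₀ ∉ S`, a local class `zt ∈ H¹(ℚ_{v₀}, E[p^k])`, (HP) and (HB6): there is `T ∈ H¹(Γ_∞, E[p^∞])` with `conj_σ T` Kummer at every finite
  `v ≠ v₀` and at `∞`, and `loc_{v₀}^{K_∞}(conj_σ T) = res (res_⊤ (κ_{v₀} zt))` for every `σ` — i.e. the three clauses of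
  `Greenberg1999.lemma46_gammaInvariants_auxPlace_rat` for the class `z = res_⊤ (κ_{v₀} zt)`.

What is still missing for H46 itself (recorded, not claimed): (HP) and (HB6) as theorems, and the Kummer lift `z ↦ zt` at `v₀`
(`LocalKummerSequenceSurjective.mem_range_map_torsionPointsMapIntertwining_iff` + `bijective_resH1Hom_subgroupIncl`, with the Weil level
compatibility `CyclotomicLayer.weilTowerPk_succ_of_coe_eq` to pass from the torsion order `p^j` of `z` to the level `p^k` of the call).

References: [GreenbergLNM1716] §4 Lemma 4.6 (p. 105), Lemma 4.7 (p. 108), Prop. 4.13 (p. 122); [MilneADT2006] Ch. I Thm. 4.10, Cor. 2.3;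
[NeukirchSchmidtWingberg2008] I §6 Prop. (1.6.4), VIII §6.
-/

set_option autoImplicit false
-- the Theorems namespace of this sub repeats the summit name by design (D-0017 nested layout)
set_option linter.dupNamespace false

noncomputable section

open scoped Classical NumberField

namespace Summit.BirchSwinnertonDyer.BirchSwinnertonDyer.Theorems

namespace TorsionEulerChar.H46Assembly

open CategoryTheory Field NumberField IsDedekindDomain
  Literature.NumberTheory.EllipticCurves Literature.NumberTheory.EllipticCurves.CyclotomicLayer
  Literature.NumberTheory.EllipticCurves.GreenbergSelmer
  Literature.NumberTheory.GaloisRepresentations Literature.NumberTheory.GaloisRepresentations.DiscreteGaloisModule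
  Literature.NumberTheory.GaloisCohomology ZpExtension
open _root_.TopRep _root_.ContinuousCohomology
open SignedLowerOffTwo.PTDeep (isUnramifiedAt_coind_torsionGaloisModule_layerSubgroup weilTowerPk_nondegenerate)

/-- **H46 realiser from the levelwise Poitou–Tate call, closed modulo the sockets (HP) and (HB6).** Notation: `M = E[p^k]`
(`ρM = W.torsionGaloisModule ((p ^ k : ℕ) : ℤ)` — the `ℕ`-cast spelling, definitionally the `(p : ℤ) ^ k` of the B5 files, so that `Finite M` is
the instance binder, discharged by `finite_geomTorsion_of_neZero W (p ^ k)`), `Γ_n = κ.layerSubgroup n`, `ρc = Maps(Γ_ℚ ⧸ Γ_n, M)`, `Sh = shapiroLift`, `Ψ = coindTateDualMor` for THE Weil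
pairing `e = weilTowerPk W k`, `θ₀ = absGaloisRestrict ℚ ℚ_{v₀}`, `T(c) = h_n (push c)`. Hypotheses: `S ⊇ Sp`, `p ∉ v` and good reduction at
every `v ∉ S`, `v₀ ∉ S`; (HP) = `Lp, Λp, hLdual, hP`; (HB6) = `hB6` for the local class `zt ∈ H¹(ℚ_{v₀}, M)`. Conclusion: the three clauses of
`lemma46_gammaInvariants_auxPlace_rat` for `z := res_⊤ (κ_{v₀} zt)`. Proof: B4 with `S₀ = {v₀}` and `t = (0 off v₀, H¹(u_{θ₀}) zt at v₀)`, whose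
orthogonality input is `hB6` through B4b; then B5 clause by clause (strict / `Sp` via `hP` / good via `isUnramifiedAt_coind_torsionGaloisModule_layerSubgroup`
/ `∞` / value at `v₀`). CONDITIONAL on (HP), (HB6); credits nothing. [cite: GreenbergLNM1716, §4 Lemma 4.6 (p. 105), Lemma 4.7 (p. 108)]
[cite: MilneADT2006, Ch. I, Thm. 4.10 and Cor. 2.3] -/
theorem exists_realiser_of_sockets (W : WeierstrassCurve ℚ) [W.IsElliptic] (p : ℕ) [Fact p.Prime] (κ : ZpExtension ℚ p)
    (hκ : κ.IsCyclotomic) (n k : ℕ) [Fintype (absoluteGaloisGroup ℚ ⧸ κ.layerSubgroup n)]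
    {s : absoluteGaloisGroup ℚ ⧸ κ.layerSubgroup n → absoluteGaloisGroup ℚ}
    (hs : ∀ x : absoluteGaloisGroup ℚ ⧸ κ.layerSubgroup n, (s x : absoluteGaloisGroup ℚ ⧸ κ.layerSubgroup n) = x)
    (hs1 : s ((1 : absoluteGaloisGroup ℚ) : absoluteGaloisGroup ℚ ⧸ κ.layerSubgroup n) = 1)
    (S Sp : Finset (HeightOneSpectrum (𝓞 ℚ))) (hSp : Sp ⊆ S)
    (hS : ∀ v : HeightOneSpectrum (𝓞 ℚ), v ∉ S → ((p : ℕ) : 𝓞 ℚ) ∉ v.asIdeal ∧ W.HasGoodReductionAt v)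
    (v₀ : HeightOneSpectrum (𝓞 ℚ)) (hv₀ : v₀ ∉ S)
    -- instances (discharged by `finite_geomTorsion_of_neZero W (p ^ k)` and `absoluteGaloisGroup_compactSpace _`; kept as binders so that
    -- this file declares no instance)
    [Finite (W.geomTorsion ((p ^ k : ℕ) : ℤ))] [CompactSpace (absoluteGaloisGroup ℚ)]
    [CompactSpace (absoluteGaloisGroup (v₀.adicCompletion ℚ))]
    -- socket (HP): the condition at the places of `Sp`
    (Lp : ∀ v : HeightOneSpectrum (𝓞 ℚ),
      AddSubgroup (galoisCohomology (((W.torsionGaloisModule ((p ^ k : ℕ) : ℤ)).coind (κ.layerSubgroup n)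
        (κ.isOpen_layerSubgroup n)).toLocal (Sum.inr v)) 1))
    (Λp : HeightOneSpectrum (𝓞 ℚ) → W.torsionH1Over ((p ^ k : ℕ) : ℤ) (κ.layerSubgroup n) → Prop)
    (hLdual : ∀ v ∈ Sp, ∀ b : W.torsionH1Over ((p ^ k : ℕ) : ℤ) (κ.layerSubgroup n),
      galoisCohomology.localization
          ((((W.torsionGaloisModule ((p ^ k : ℕ) : ℤ)).coind (κ.layerSubgroup n) (κ.isOpen_layerSubgroup n)).tateDual (p ^ k)))
          (Sum.inr v) 1
          (cohomologyMap (coindTateDualMor (W.torsionGaloisModule ((p ^ k : ℕ) : ℤ)) (W.torsionGaloisModule ((p ^ k : ℕ) : ℤ))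
              (κ.layerSubgroup n)
              (pairingHomOfFun (p ^ k) (weilTowerPk W k) (weilTowerPk_pow W k) (weilTowerPk_add_left W k) (weilTowerPk_add_right W k))
              (κ.isOpen_layerSubgroup n)
              (fun σ a b => (contPairingOfFun (W.torsionGaloisModule ((p ^ k : ℕ) : ℤ)) (p ^ k) (weilTowerPk W k) (weilTowerPk_pow W k)
                (weilTowerPk_add_left W k) (weilTowerPk_add_right W k) (weilTowerPk_smul W k)).toLin_smul σ a b)) 1
            (shapiroLift (W.torsionGaloisModule ((p ^ k : ℕ) : ℤ)).toTopRep (κ.layerSubgroup n) (κ.isOpen_layerSubgroup n) hs hs1 b)) ∈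
        (LocalInvariants.canonical ℚ (p ^ k)).dualLocalCondition
          ((W.torsionGaloisModule ((p ^ k : ℕ) : ℤ)).coind (κ.layerSubgroup n) (κ.isOpen_layerSubgroup n)) (Sum.inr v) (Lp v) →
      Λp v b)
    (hP : ∀ v ∈ Sp, ∀ c : W.torsionH1Over ((p ^ k : ℕ) : ℤ) (κ.layerSubgroup n),
      galoisCohomology.localization ((W.torsionGaloisModule ((p ^ k : ℕ) : ℤ)).coind (κ.layerSubgroup n) (κ.isOpen_layerSubgroup n))
          (Sum.inr v) 1
          (shapiroLift (W.torsionGaloisModule ((p ^ k : ℕ) : ℤ)).toTopRep (κ.layerSubgroup n) (κ.isOpen_layerSubgroup n) hs hs1 c) ∈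
        Lp v →
      ∀ σ : absoluteGaloisGroup ℚ,
        W.conjH1 p κ.kerSubgroup σ (W.layerToInfty κ n
          (resH1Hom (N := W.geomPrimaryTorsion p) (subgroupInclusion (le_refl (κ.layerSubgroup n)))
            (AddSubgroup.inclusion (AcSigned.geomTorsion_zpow_le_geomPrimaryTorsion W p k)) (fun _ _ ↦ rfl) c)) ∈
          W.localKerOver p κ.kerSubgroup (v.adicCompletion ℚ))
    -- the local class at `v₀`
    (zt : continuousCohomology 1
      (TopRep.res (absGaloisRestrict ℚ (v₀.adicCompletion ℚ) : absoluteGaloisGroup (v₀.adicCompletion ℚ) →* absoluteGaloisGroup ℚ)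
        (W.torsionGaloisModule ((p ^ k : ℕ) : ℤ)).toTopRep))
    -- socket (HB6): orthogonality at `v₀`
    (hB6 : ∀ b : W.torsionH1Over ((p ^ k : ℕ) : ℤ) (κ.layerSubgroup n),
      (∀ w : HeightOneSpectrum (𝓞 ℚ), w ∉ S → w ∉ ({v₀} : Finset (HeightOneSpectrum (𝓞 ℚ))) →
        galoisCohomology.localization ((W.torsionGaloisModule ((p ^ k : ℕ) : ℤ)).coind (κ.layerSubgroup n) (κ.isOpen_layerSubgroup n))
            (Sum.inr w) 1
            (shapiroLift (W.torsionGaloisModule ((p ^ k : ℕ) : ℤ)).toTopRep (κ.layerSubgroup n) (κ.isOpen_layerSubgroup n) hs hs1 b) ∈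
          unramifiedSubgroup (GaloisRep.toLocal w
            ((W.torsionGaloisModule ((p ^ k : ℕ) : ℤ)).coind (κ.layerSubgroup n) (κ.isOpen_layerSubgroup n))) 1) →
      (∀ v ∈ Sp, Λp v b) →
      LocalInvariants.canonical ℚ (p ^ k) (Sum.inr v₀)
        ((((contPairingOfFun (W.torsionGaloisModule ((p ^ k : ℕ) : ℤ)) (p ^ k) (weilTowerPk W k) (weilTowerPk_pow W k)
            (weilTowerPk_add_left W k) (weilTowerPk_add_right W k) (weilTowerPk_smul W k)).restrict
            (absGaloisRestrict ℚ (v₀.adicCompletion ℚ))).cupProduct zt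
          (ContinuousCohomology.map (absGaloisRestrict ℚ (v₀.adicCompletion ℚ))
            (𝟙 (TopRep.res (absGaloisRestrict ℚ (v₀.adicCompletion ℚ) :
              absoluteGaloisGroup (v₀.adicCompletion ℚ) →* absoluteGaloisGroup ℚ) (W.torsionGaloisModule ((p ^ k : ℕ) : ℤ)).toTopRep)) 1
            (cores (W.torsionGaloisModule ((p ^ k : ℕ) : ℤ)).toTopRep (κ.layerSubgroup n) (κ.isOpen_layerSubgroup n) b)))) = 0) :
    ∃ T : W.subgroupH1 p κ.kerSubgroup,
      (∀ v : HeightOneSpectrum (𝓞 ℚ), v ≠ v₀ → ∀ σ : absoluteGaloisGroup ℚ,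
        W.conjH1 p κ.kerSubgroup σ T ∈ W.localKerOver p κ.kerSubgroup (v.adicCompletion ℚ)) ∧
      (∀ (w : InfinitePlace ℚ) (σ : absoluteGaloisGroup ℚ),
        W.conjH1 p κ.kerSubgroup σ T ∈ W.localKerOver p κ.kerSubgroup w.Completion) ∧
      ∀ σ : absoluteGaloisGroup ℚ,
        W.localResOver p κ.kerSubgroup (v₀.adicCompletion ℚ) (W.conjH1 p κ.kerSubgroup σ T) =
          Literature.NumberTheory.EllipticCurves.resOfLe (localPoints W (v₀.adicCompletion ℚ))
            (Subgroup.comap_mono le_top :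
              localSubgroup κ.kerSubgroup (v₀.adicCompletion ℚ) ≤
                localSubgroup (⊤ : Subgroup (absoluteGaloisGroup ℚ)) (v₀.adicCompletion ℚ))
            (resH1Hom (Literature.NumberTheory.EllipticCurves.subgroupIncl
                (localSubgroup (⊤ : Subgroup (absoluteGaloisGroup ℚ)) (v₀.adicCompletion ℚ)))
              (AddMonoidHom.id (localPoints W (v₀.adicCompletion ℚ))) (fun _ _ ↦ rfl)
              (galoisCohomology.map (W.torsionPointsMapIntertwining ((p ^ k : ℕ) : ℤ) (v₀.adicCompletion ℚ)) 1 zt)) := by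
  haveI : CompactSpace (absoluteGaloisGroup (Place.Completion (Sum.inr v₀ : Place ℚ))) :=
    inferInstanceAs (CompactSpace (absoluteGaloisGroup (v₀.adicCompletion ℚ)))
  /- ### B4's side conditions -/
  have hS' : ∀ w : HeightOneSpectrum (𝓞 ℚ), w ∉ S →
      ((p ^ k : ℕ) : 𝓞 ℚ) ∉ w.asIdeal ∧ GaloisRep.IsUnramifiedAt w (W.torsionGaloisModule ((p ^ k : ℕ) : ℤ)) ∧
        (p : 𝓞 ℚ) ∉ w.asIdeal := by
    intro w hw
    obtain ⟨hpw, hgood⟩ := hS w hw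
    refine ⟨?_, ?_, hpw⟩
    · rw [Nat.cast_pow]
      exact fun h ↦ hpw (w.isPrime.mem_of_pow_mem k h)
    · refine Summit.BirchSwinnertonDyer.BirchSwinnertonDyer.Rank1Residual.TorsionUnramified.isUnramifiedAt_torsionGaloisModule_of_hasGoodReductionAt
        W hgood ?_
      rw [Int.cast_natCast, Nat.cast_pow]
      exact fun h ↦ hpw (w.isPrime.mem_of_pow_mem k h)
  have hS₀ : Disjoint ({v₀} : Finset (HeightOneSpectrum (𝓞 ℚ))) S := Finset.disjoint_singleton_left.mpr hv₀
  /- ### the unit `u_{θ₀} : M|_{θ₀} ⟶ Maps(Γ_ℚ ⧸ Γ_n, M)|_{θ₀}` (constant functions) -/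
  obtain ⟨uθ, hu⟩ : ∃ uθ : TopRep.res (absGaloisRestrict ℚ (v₀.adicCompletion ℚ) :
        absoluteGaloisGroup (v₀.adicCompletion ℚ) →* absoluteGaloisGroup ℚ) (W.torsionGaloisModule ((p ^ k : ℕ) : ℤ)).toTopRep ⟶
      TopRep.res (absGaloisRestrict ℚ (v₀.adicCompletion ℚ) : absoluteGaloisGroup (v₀.adicCompletion ℚ) →* absoluteGaloisGroup ℚ)
        (coindFin (W.torsionGaloisModule ((p ^ k : ℕ) : ℤ)).toTopRep (κ.layerSubgroup n)),
      ∀ (x : W.geomTorsion ((p ^ k : ℕ) : ℤ)) (y : absoluteGaloisGroup ℚ ⧸ κ.layerSubgroup n),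
        (uθ.hom x : absoluteGaloisGroup ℚ ⧸ κ.layerSubgroup n → W.geomTorsion ((p ^ k : ℕ) : ℤ)) y = x :=
    ⟨TopRep.ofHom ⟨((W.torsionGaloisModule ((p ^ k : ℕ) : ℤ)).coindOpenUnit (κ.layerSubgroup n)
        (κ.isOpen_layerSubgroup n)).hom.toContinuousLinearMap, fun d =>
      ((W.torsionGaloisModule ((p ^ k : ℕ) : ℤ)).coindOpenUnit (κ.layerSubgroup n) (κ.isOpen_layerSubgroup n)).hom.isIntertwining'
        (absGaloisRestrict ℚ (v₀.adicCompletion ℚ) d)⟩, fun _ _ => rfl⟩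
  /- ### B4: the levelwise Poitou–Tate call with `S₀ = {v₀}`, `t = (0 off v₀, H¹(u_{θ₀}) zt at v₀)`; orthogonality = B4b + (HB6) -/
  obtain ⟨c, hc₁, hc₂, hc₃, hc₄, hc₅⟩ :=
    H46Levelwise.exists_layerClass_prescribed_of_orthogonal (W.torsionGaloisModule ((p ^ k : ℕ) : ℤ)) (p ^ k) (weilTowerPk W k)
      (weilTowerPk_pow W k) (weilTowerPk_add_left W k) (weilTowerPk_add_right W k) (weilTowerPk_smul W k)
      (weilTowerPk_nondegenerate W k) (fun m => AddSubgroup.torsionBy.nsmul (A := W.geomPoints) (n := p ^ k) m)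
      κ n hs hs1 S Sp {v₀} hSp hS₀ hS' Lp Λp hLdual
      (Function.update (fun w => (0 : galoisCohomology (((W.torsionGaloisModule ((p ^ k : ℕ) : ℤ)).coind (κ.layerSubgroup n)
        (κ.isOpen_layerSubgroup n)).toLocal (Sum.inr w)) 1)) v₀ (cohomologyMap uθ 1 zt))
      (fun b hb₁ hb₂ => by
        rw [Finset.sum_singleton, Function.update_self]
        exact (H46Obstruction.localTatePairingZMod_unit_coindTateDual_shapiroLift (W.torsionGaloisModule ((p ^ k : ℕ) : ℤ))
          (κ.layerSubgroup n) (κ.isOpen_layerSubgroup n) hs hs1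
          (pairingHomOfFun (p ^ k) (weilTowerPk W k) (weilTowerPk_pow W k) (weilTowerPk_add_left W k) (weilTowerPk_add_right W k))
          (fun σ a b => (contPairingOfFun (W.torsionGaloisModule ((p ^ k : ℕ) : ℤ)) (p ^ k) (weilTowerPk W k) (weilTowerPk_pow W k)
            (weilTowerPk_add_left W k) (weilTowerPk_add_right W k) (weilTowerPk_smul W k)).toLin_smul σ a b)
          (Sum.inr v₀) (LocalInvariants.canonical ℚ (p ^ k)) uθ hu zt b).trans (hB6 b hb₁ hb₂))
  /- ### B5: the realiser `T(c) = h_n (push c)` clause by clause -/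
  refine ⟨W.layerToInfty κ n (resH1Hom (N := W.geomPrimaryTorsion p) (subgroupInclusion (le_refl (κ.layerSubgroup n)))
      (AddSubgroup.inclusion (AcSigned.geomTorsion_zpow_le_geomPrimaryTorsion W p k)) (fun _ _ ↦ rfl) c), ?_, ?_, ?_⟩
  · intro v hv σ
    by_cases hvS : v ∈ S
    · by_cases hvp : v ∈ Sp
      · -- places of `Sp`: socket (HP)
        exact hP v hvp c (hc₄ v hvp) σ
      · -- strict places `S ∖ Sp`
        exact H46Realiser.conjH1_realiser_mem_localKerOver_of_localization_shapiroLift_eq_zero W p κ n k hs hs1 v c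
          (hc₂ v hvS hvp) σ
    · -- good places `v ∉ S`, `v ≠ v₀`
      exact H46Realiser.conjH1_realiser_mem_localKerOver_of_localization_shapiroLift_mem_unramified W p κ hκ n k hs hs1 v
        (hS v hvS).1 (hS v hvS).2 (isUnramifiedAt_coind_torsionGaloisModule_layerSubgroup κ W n k (hS v hvS).1 (hS v hvS).2) c
        (hc₁ v hvS (fun h => hv (Finset.mem_singleton.mp h))) σ
  · -- infinite places
    exact fun w σ => H46Realiser.conjH1_realiser_mem_localKerOver_completion_of_localization_shapiroLift_eq_zero W p κ n k hs hs1
      w c (hc₃ w) σ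
  · -- the value at `v₀`
    intro σ
    exact H46Realiser.localResOver_conjH1_realiser_eq_resOfLe_of_localization_shapiroLift_eq W p κ n k hs hs1 v₀ uθ hu c zt
      ((hc₅ v₀ (Finset.mem_singleton_self v₀)).trans (Function.update_self _ _ _)) σ


/-- **The Kummer lift at the auxiliary place (the input of `exists_realiser_of_sockets`).** For a `K`-field `E` of characteristic `0`
(a completion `K_v`) and `m ≠ 0`, every class `z ∈ H¹(Γ_E|_⊤, E(Ē))` killed by `m` is `res_⊤ (κ_E zt)` for some `zt ∈ H¹(Γ_E, E[m])`:
the restriction `res_⊤ : H¹(Γ_E, E(Ē)) → H¹(Γ_E|_⊤, E(Ē))` to the full local subgroup is bijective (`bijective_resH1Hom_subgroupIncl`) and the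
image of the local Kummer map `κ_E = H¹(pointsMap) : H¹(E, E[m]) → H¹(E, E(Ē))` is exactly the `m`-torsion
(`mem_range_map_torsionPointsMapIntertwining_iff`, Silverman X §4 diagram (**)). [cite: SilvermanAEC2009, X.§4 diagram (**)]
[cite: GreenbergLNM1716, §4 Lemma 4.6 (p. 105)] -/
theorem exists_eq_resTop_kummer_of_zsmul_eq_zero {K : Type} [Field K] [NumberField K] (W : WeierstrassCurve K) [W.IsElliptic]
    (E : Type) [Field E] [Algebra K E] [CharZero E] {m : ℤ} (hm : m ≠ 0)
    (z : discreteH1 (localSubgroup (⊤ : Subgroup (absoluteGaloisGroup K)) E) (localPoints W E)) (hz : m • z = 0) :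
    ∃ zt : galoisCohomology (GaloisRep.restrictField E (W.torsionGaloisModule m)) 1,
      resH1Hom (Literature.NumberTheory.EllipticCurves.subgroupIncl (localSubgroup (⊤ : Subgroup (absoluteGaloisGroup K)) E))
          (AddMonoidHom.id (localPoints W E)) (fun _ _ ↦ rfl)
          (galoisCohomology.map (W.torsionPointsMapIntertwining m E) 1 zt) = z := by
  have hbij := bijective_resH1Hom_subgroupIncl (localPoints W E) (localSubgroup (⊤ : Subgroup (absoluteGaloisGroup K)) E)
    mem_localSubgroup_top
  obtain ⟨a, rfl⟩ := hbij.2 z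
  have ha : m • a = 0 := hbij.1 (by rw [map_zsmul, hz, map_zero])
  obtain ⟨zt, hzt⟩ := (W.mem_range_map_torsionPointsMapIntertwining_iff E hm a).mpr ha
  exact ⟨zt, by rw [hzt]⟩

end TorsionEulerChar.H46Assembly

end Summit.BirchSwinnertonDyer.BirchSwinnertonDyer.Theorems

end
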